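import Literature.NumberTheory.EllipticCurves.IwasawaTowerTorsionProofs
import Literature.NumberTheory.EllipticCurves.SubgroupSelmerCocycleCriteriaProofs
import Literature.NumberTheory.EllipticCurves.TateModuleProjSurjectiveProofs
import Literature.NumberTheory.EllipticCurves.AnticyclotomicSignedCompactSelmer
import Literature.NumberTheory.EllipticCurves.TateModuleContinuityProofs
import Literature.NumberTheory.EllipticCurves.PeriodIndexCorestrictionLocal
import Literature.NumberTheory.EllipticCurves.H1UnramifiedFinite
import HarnessLib

/-!
# The coefficient maps `H¹(K_∞, E[p^k]) → H¹(K_∞, E[p^∞])` over a `ℤ_p`-extension: injective when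
# `E(K)[p] = 0`, onto the `p^k`-torsion always; and `E[p^k]^{Gal(K̄/K_∞)} = 0` (proofs file)

Topic `NumberTheory/EllipticCurves` (cell `pub/bsd-print-x9`, blueprint HOME/p2/S1-DISCRETE-CONTROL §1(c)/(d); sequel to
`IwasawaTowerTorsionProofs` (`fixedPoints_kerSubgroup_geomPrimaryTorsion_eq_bot`: `E(K)[p] = 0 ⇒ E(K_∞)[p^∞] = 0`) and the
cocycle criteria of `SubgroupSelmerCocycleCriteriaProofs`). THEOREMS ONLY; no definition, no named fact, no instance, no `sorry`.

For an elliptic curve `E = V` over a number field `K`, a prime `p`, a `ℤ_p`-extension `K_∞/K` (`κ`, `Gal(K̄/K_∞) = ker κ`)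
and the inclusion `E[p^k] ↪ E[p^∞]` of discrete `Γ_K`-modules:

* `geomTorsion_eq_zero_of_forall_kerSubgroup_smul_eq` — **`E[p^k]^{Gal(K̄/K_∞)} = 0`** when `E(K)[p] = 0` (the brick `hfix`
  of `ZpExtensionEisensteinTowerReadoutCurve.eq_zero_of_eisensteinTowerReadout_eq_zero`);
* `resH1Hom_inclusion_geomTorsion_injective` — **`H¹(K_∞, E[p^k]) → H¹(K_∞, E[p^∞])` is injective** when `E(K)[p] = 0`
  (its kernel is `E(K_∞)[p^∞]/p^k = 0`; the brick `hjinj`);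
* `exists_resH1Hom_inclusion_geomTorsion_eq` — **it is onto the `p^k`-torsion `H¹(K_∞, E[p^∞])[p^k]`** (no hypothesis:
  `E(K̄)` is divisible, `nsmul_geomPoints_surjective`), and `exists_resH1Hom_inclusion_geomTorsion_eq_of_subgroupH1` —
  every class of `H¹(K_∞, E[p^∞])` comes from some `H¹(K_∞, E[p^k])`.

These are the two ends of the Kummer sequence `0 → E(K_∞)[p^∞]/p^k → H¹(K_∞, E[p^k]) → H¹(K_∞, E[p^∞])[p^k] → 0`
[Greenberg LNM 1716, §2 p. 71 and §4 p. 98], proved directly on continuous cocycles (`oneCocycleClass_surjective`,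
`oneCocycleClass_eq_zero_iff`, `CocycleCriteria.resH1Hom_oneCocycleClass_eq_zero_iff`, `map_oneCocycleClass`).
They make Howard's readout `H¹(K, A_𝔮) → H¹(K_∞, E[p^∞])[𝔮]` injective and identify its image levelwise
(`ZpExtensionEisensteinTowerReadoutBijectiveProofs`).  BSD is not proved by any of this.

References: [GreenbergLNM1716] §2 (p. 71), §4 (pp. 98, 109); [Howard2004HeegnerKolyvagin] §2.2, Lemma 2.2.9 / proof of
Thm. 2.2.10; [SerreGaloisCohomology1997] I §2.2–2.4.
-/

noncomputable section

open scoped Classical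

open Literature.NumberTheory.EllipticCurves Literature.NumberTheory.GaloisRepresentations Field

universe u

namespace WeierstrassCurve

variable {K : Type u} [Field K] [NumberField K] (V : WeierstrassCurve K) [V.IsElliptic] {p : ℕ} [hp : Fact p.Prime]
  (κ : ZpExtension K p)

/-! ## §1 `E[p^k]^{Gal(K̄/K_∞)} = 0` -/

/-- **`E[p^k]^{Gal(K̄/K_∞)} = 0` when `E(K)[p] = 0`**: a geometric `p^k`-torsion point fixed by `Gal(K̄/K_∞) = ker κ` lies in
`E(K_∞)[p^∞] = E[p^∞]^{ker κ} = 0` (`fixedPoints_kerSubgroup_geomPrimaryTorsion_eq_bot`).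
[cite: GreenbergLNM1716, §4 p. 109 (E(F_∞)[p^∞] = 0 when E(F)[p] = 0)] [cite: Howard2004HeegnerKolyvagin, Lemma 2.2.9] -/
theorem geomTorsion_eq_zero_of_forall_kerSubgroup_smul_eq (hE : ∀ P : V.toAffine.Point, p • P = 0 → P = 0) (k : ℕ)
    (a : geomTorsion V ((p : ℤ) ^ k)) (ha : ∀ σ ∈ κ.kerSubgroup, σ • a = a) : a = 0 := by
  have hbot := V.fixedPoints_kerSubgroup_geomPrimaryTorsion_eq_bot κ hE
  set b : geomPrimaryTorsion V p := AddSubgroup.inclusion (AcSigned.geomTorsion_zpow_le_geomPrimaryTorsion V p k) a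
    with hb
  have hmem : b ∈ FixedPoints.addSubgroup κ.kerSubgroup (geomPrimaryTorsion V p) := by
    rw [FixedPoints.mem_addSubgroup]
    rintro ⟨τ, hτ⟩
    apply Subtype.ext
    rw [Subgroup.mk_smul, primaryComponent.coe_smul, hb, AddSubgroup.coe_inclusion,
      ← AddSubgroup.torsionBy.coe_smul, ha τ hτ]
  rw [hbot, AddSubgroup.mem_bot] at hmem
  apply Subtype.ext
  have h := congrArg Subtype.val hmem
  rwa [hb, AddSubgroup.coe_inclusion] at h

/-! ## §2 `H¹(K_∞, E[p^k]) → H¹(K_∞, E[p^∞])` is injective -/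

/-- **`H¹(K_∞, E[p^k]) → H¹(K_∞, E[p^∞])` is injective when `E(K)[p] = 0`.**  On cocycles: if `z : Gal(K̄/K_∞) → E[p^k]`
becomes the coboundary of `n ∈ E[p^∞]`, then `p^k n` is `Gal(K̄/K_∞)`-fixed, hence `0` (`E(K_∞)[p^∞] = 0`), so
`n ∈ E[p^k]` and `z` is already a coboundary there — the kernel `E(K_∞)[p^∞]/p^k E(K_∞)[p^∞]` of the Kummer sequence
vanishes. [cite: GreenbergLNM1716, §2 p. 71 and §4 p. 109] [cite: Howard2004HeegnerKolyvagin, Lemma 2.2.9 and proof of Thm. 2.2.10] -/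
theorem resH1Hom_inclusion_geomTorsion_injective (hE : ∀ P : V.toAffine.Point, p • P = 0 → P = 0) (k : ℕ) :
    Function.Injective (resH1Hom (ContinuousMonoidHom.id κ.kerSubgroup)
      (AddSubgroup.inclusion (AcSigned.geomTorsion_zpow_le_geomPrimaryTorsion V p k)) (fun _ _ ↦ rfl)) := by
  rw [injective_iff_map_eq_zero]
  intro x hx
  obtain ⟨z, rfl⟩ := oneCocycleClass_surjective _ x
  obtain ⟨n, hn⟩ := (CocycleCriteria.resH1Hom_oneCocycleClass_eq_zero_iff _ _ _ z).1 hx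
  -- `hn : ∀ τ, incl (z τ) = τ • n - n`; hence `p^k • n` is fixed by `ker κ`
  have hfixed : p ^ k • n ∈ FixedPoints.addSubgroup κ.kerSubgroup (geomPrimaryTorsion V p) := by
    rw [FixedPoints.mem_addSubgroup]
    intro τ
    have h1 : p ^ k • (AddSubgroup.inclusion (AcSigned.geomTorsion_zpow_le_geomPrimaryTorsion V p k)
        (z.1 (ContinuousMonoidHom.id κ.kerSubgroup τ))) = 0 := by
      apply Subtype.ext
      rw [AddSubgroupClass.coe_nsmul, AddSubgroup.coe_inclusion, ZeroMemClass.coe_zero, ← natCast_zsmul, Nat.cast_pow]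
      exact (mem_geomTorsion_iff V _ _).1 (z.1 (ContinuousMonoidHom.id κ.kerSubgroup τ)).2
    rw [hn τ, nsmul_sub, sub_eq_zero] at h1
    have h2 : τ • (p ^ k • n) = p ^ k • (τ • n) := map_nsmul (DistribSMul.toAddMonoidHom (geomPrimaryTorsion V p) τ) (p ^ k) n
    rw [h2]
    exact h1
  rw [V.fixedPoints_kerSubgroup_geomPrimaryTorsion_eq_bot κ hE, AddSubgroup.mem_bot] at hfixed
  -- so `n ∈ E[p^k]`
  have hn' : (n : geomPoints V) ∈ geomTorsion V ((p : ℤ) ^ k) := by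
    rw [mem_geomTorsion_iff, ← Nat.cast_pow, natCast_zsmul]
    have h := congrArg Subtype.val hfixed
    rwa [AddSubgroupClass.coe_nsmul] at h
  -- and `z` is the coboundary of `⟨n, hn'⟩`
  rw [oneCocycleClass_eq_zero_iff]
  refine ⟨⟨n, hn'⟩, fun g ↦ Subtype.ext ?_⟩
  have h := congrArg Subtype.val (hn g)
  rw [AddSubgroup.coe_inclusion, AddSubgroupClass.coe_sub, Subgroup.smul_def, primaryComponent.coe_smul] at h
  exact h.trans rfl

/-! ## §3 `H¹(K_∞, E[p^k]) → H¹(K_∞, E[p^∞])[p^k]` is onto -/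

omit [NumberField K] in
/-- **`H¹(K_∞, E[p^k])` maps onto `H¹(K_∞, E[p^∞])[p^k]`** (any elliptic curve, no hypothesis on `E(K)[p]`): if
`p^k [z] = 0`, i.e. `p^k z` is the coboundary of `v ∈ E[p^∞]`, write `v = p^k w` (`E(K̄)` is divisible,
`nsmul_geomPoints_surjective`; `w ∈ E[p^∞]`); then `z − ∂w` takes values in `E[p^k]` and has the same class.
[cite: GreenbergLNM1716, §2 p. 71 (Kummer sequence over F_∞)] [cite: Howard2004HeegnerKolyvagin, proof of Thm. 2.2.10] -/
theorem exists_resH1Hom_inclusion_geomTorsion_eq (k : ℕ) (s : V.subgroupH1 p κ.kerSubgroup) (hs : p ^ k • s = 0) :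
    ∃ s' : Literature.NumberTheory.EllipticCurves.subgroupH1 κ.kerSubgroup (geomTorsion V ((p : ℤ) ^ k)),
      resH1Hom (ContinuousMonoidHom.id κ.kerSubgroup)
        (AddSubgroup.inclusion (AcSigned.geomTorsion_zpow_le_geomPrimaryTorsion V p k)) (fun _ _ ↦ rfl) s' = s := by
  haveI := continuousSMul_geomPoints' V
  obtain ⟨z, rfl⟩ := oneCocycleClass_surjective _ s
  rw [← Nat.cast_smul_eq_nsmul ℤ, ← oneCocycleClass_smul, oneCocycleClass_eq_zero_iff] at hs
  obtain ⟨v, hv⟩ := hs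
  -- `hv : ∀ g, (p^k • z) g = g • v - v`; divide `v` by `p^k`
  have hpk : p ^ k ≠ 0 := pow_ne_zero _ hp.out.ne_zero
  obtain ⟨w₀, hw₀⟩ := V.nsmul_geomPoints_surjective hpk (v : geomPoints V)
  have hw₀mem : w₀ ∈ geomPrimaryTorsion V p := by
    obtain ⟨j, hj⟩ := v.2
    refine ⟨k + j, ?_⟩
    rw [pow_add, mul_nsmul]
    have h0 : p ^ k • w₀ = (v : geomPoints V) := hw₀
    rw [h0, hj]
  set w : geomPrimaryTorsion V p := ⟨w₀, hw₀mem⟩ with hw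
  have hwv : p ^ k • w = v := Subtype.ext (by rw [AddSubgroupClass.coe_nsmul]; exact hw₀)
  -- the corrected cocycle `z' = z - ∂w` takes values in `E[p^k]`
  have hval : ∀ g : κ.kerSubgroup, ((z.1 g - (g • w - w) : geomPrimaryTorsion V p) : geomPoints V) ∈
      geomTorsion V ((p : ℤ) ^ k) := by
    intro g
    rw [mem_geomTorsion_iff, ← Nat.cast_pow, natCast_zsmul, ← AddSubgroupClass.coe_nsmul, nsmul_sub, nsmul_sub]
    have h1 : p ^ k • z.1 g = ((((p ^ k : ℕ) : ℤ)) • z).1 g := by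
      change p ^ k • z.1 g = (((p ^ k : ℕ) : ℤ)) • z.1 g
      rw [natCast_zsmul]
    have h2 : p ^ k • (g • w) = g • (p ^ k • w) :=
      (map_nsmul (DistribSMul.toAddMonoidHom (geomPrimaryTorsion V p) g) (p ^ k) w).symm
    rw [h1, hv g, h2, hwv]
    change (((g • v - v) - (g • v - v) : geomPrimaryTorsion V p) : geomPoints V) = 0
    rw [sub_self, ZeroMemClass.coe_zero]
  let f : κ.kerSubgroup → geomTorsion V ((p : ℤ) ^ k) := fun g ↦ ⟨_, hval g⟩
  have hcont0 : Continuous fun g : κ.kerSubgroup ↦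
      ((z.1 g - (g • w - w) : geomPrimaryTorsion V p) : geomPoints V) := by
    exact (continuous_subtype_val.comp z.1.continuous).sub
      ((continuous_subtype_val.smul continuous_const).sub continuous_const)
  have hfcont : Continuous f := hcont0.subtype_mk _
  have hfval : ∀ g, AddSubgroup.inclusion (AcSigned.geomTorsion_zpow_le_geomPrimaryTorsion V p k) (f g) =
      z.1 g - (g • w - w) := fun g ↦ Subtype.ext rfl
  have hfcoc : (⟨f, hfcont⟩ : C(κ.kerSubgroup, geomTorsion V ((p : ℤ) ^ k))) ∈
      contOneCocycles (discreteTopRep κ.kerSubgroup (geomTorsion V ((p : ℤ) ^ k))) := by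
    rw [mem_contOneCocycles_iff]
    intro g h
    apply AddSubgroup.inclusion_injective (AcSigned.geomTorsion_zpow_le_geomPrimaryTorsion V p k)
    change AddSubgroup.inclusion _ (f (g * h)) = AddSubgroup.inclusion _ (f g + g • f h)
    rw [map_add, hfval, hfval]
    have h3 : AddSubgroup.inclusion (AcSigned.geomTorsion_zpow_le_geomPrimaryTorsion V p k) (g • f h) =
        g • AddSubgroup.inclusion (AcSigned.geomTorsion_zpow_le_geomPrimaryTorsion V p k) (f h) := rfl
    rw [h3, hfval, z.2 g h]
    change z.1 g + g • z.1 h - ((g * h) • w - w) = z.1 g - (g • w - w) + g • (z.1 h - (h • w - w))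
    rw [mul_smul, smul_sub, smul_sub]
    abel
  refine ⟨oneCocycleClass _ ⟨⟨f, hfcont⟩, hfcoc⟩, ?_⟩
  -- `incl_* [f] = [incl ∘ f] = [z - ∂w] = [z]`
  rw [resH1Hom_oneCocycleClass, ← sub_eq_zero, ← oneCocycleClass_sub, oneCocycleClass_eq_zero_iff]
  refine ⟨-w, fun g ↦ ?_⟩
  rw [Submodule.coe_sub, ContinuousMap.sub_apply, pullback_resHomOfEquivariant_apply, discreteTopRep_ρ_apply]
  change AddSubgroup.inclusion _ (f g) - z.1 g = g • -w - -w
  rw [hfval, smul_neg]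
  abel

/-- **Every class of `H¹(K_∞, E[p^∞])` comes from `H¹(K_∞, E[p^k])` for some `k`** (it is killed by some `p^k`,
`exists_pow_smul_subgroupH1_ker_eq_zero`, then `exists_resH1Hom_inclusion_geomTorsion_eq`); `k` may be taken `≥ k₀`.
[cite: GreenbergLNM1716, §1 p. 60 and §2 p. 71] -/
theorem exists_resH1Hom_inclusion_geomTorsion_eq_of_subgroupH1 (k₀ : ℕ) (s : V.subgroupH1 p κ.kerSubgroup) :
    ∃ (k : ℕ) (_ : k₀ ≤ k) (s' : Literature.NumberTheory.EllipticCurves.subgroupH1 κ.kerSubgroup (geomTorsion V ((p : ℤ) ^ k))),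
      resH1Hom (ContinuousMonoidHom.id κ.kerSubgroup)
        (AddSubgroup.inclusion (AcSigned.geomTorsion_zpow_le_geomPrimaryTorsion V p k)) (fun _ _ ↦ rfl) s' = s := by
  obtain ⟨j, hj⟩ := V.exists_pow_smul_subgroupH1_ker_eq_zero κ s
  have hs : p ^ (k₀ + j) • s = 0 := by rw [pow_add, mul_nsmul', hj, smul_zero]
  obtain ⟨s', hs'⟩ := V.exists_resH1Hom_inclusion_geomTorsion_eq κ (k₀ + j) s hs
  exact ⟨k₀ + j, Nat.le_add_right _ _, s', hs'⟩

end WeierstrassCurve
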